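import Summits.AtomisticToContinuum.Crystallization.Theorems.FrustratedLawDichotomyCellArithNash
import Summits.AtomisticToContinuum.Crystallization.Theorems.FrustratedLawDichotomyCellTriples

/-!
# FrustratedLawDichotomy · crux `AperiodicFrustratedLawGap` (stmt-AtomisticToContinuum-27623) — CELL-ARITH / TAILS: THE HOST-FORCE COLUMN
# BY MIRROR SYMMETRY IN THE LABEL FRAME (decomp-a2c hand-1 g54; label-frame package of (hand-1 g52) `…CertFloorTailsHost`, critic r1805 (B5))

Ruling of record (crit r1805 (B5)): for BRAVAIS templates (fcc, F1, every band member) the host-force column `Σ_{m∈MI} ⟪Y m, H_m⟫`,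
`H_m = Σ_{m'∈M∖m} ljBondForce (pos m − pos m')`, of the class-A certificate floor is booked by the MIRROR lemma — no pair list, no `L_h`:
the bonds `m'` whose label mirror `2m − m'` is again a template label cancel in pairs (odd force), and the unmirrored rest lies beyond
`R_w − ‖pos m‖` (window completeness), so it is booked by the shell sum `T0_δ = psiTail δ`.  This file states that package so that the
TRUNCATED MASTER (251) `…CellTailsRem.lb_le_certFloorL_trunc` is called UNCHANGED, with

* `nbh := mirrorNbh M mir` — the near list of an interior label `m` is the MIRROR CORE `{m' ∈ M ∣ mir m m' ∈ M}` (§1);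
* `hnbh` ⟸ ★ `lh_le_dist_of_window` / `hnbh_of_window` (the hypothesis verbatim) — WINDOW COMPLETENESS «every admissible label placed
  inside radius `R_w` is in `M`» and `Lh m + ‖pos m‖ ≤ R_w` give `m' ∉ mirrorNbh ⇒ Lh m ≤ dist (pos m') (pos m)` (§2);
* `hhf` ⟸ ★ `sum_ljBondForce_mirrorNbh_eq_zero` (the near part VANISHES for every interior label — no symmetry lever is needed for this
  column) and ★ `hhf_of_mirror`: the entry is `‖Y m‖·T0_δ(Lh m) ≤ hf m` (§1, §3);
* the number: ★ `norm_mul_psiTail_le_reading` — `hf m := scHi yb (rdHi S (psiTailQ δ Lh))/S` from a norm witness `‖posL F (ω m)‖ ≤ yb`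
  (Gram frame, (hand-1 g53) CELL-ARITH readings; §3);
* the column form ★ `hostColumnL_le_of_mirror` — `Σ_{m∈MI}⟪Y m, H_m⟫ ≤ Σ_{m∈MI} ‖Y m‖·T0_δ(Lh m)`, the label twin of
  `…CertFloorTailsHost.hostColumn_abs_le_of_window` (§2);
* §4 the INTEGER-TRIPLE instance (labels `ℤ × ℤ × ℤ`, (268) `zT`): `mirT m m' := 2m − m'`, involution / template linearity
  (`cast ∘ zT (mirT m m') = 2•(cast ∘ zT m) − cast ∘ zT m'` ⇒ bond reversal by (252) `posL_mirror` for `h•z` and `T *ᵥ z` templates),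
  parity closure `Even (sumT m') → Even (sumT (mirT m m'))`, and the near-identity form of window completeness
  (`R_w² ≤ (1 − 3ε)·|a x|²` off `M` ⇒ `R_w ≤ ‖posL F (a x)‖`, (260) `le_norm_of_nearId`).
Non-Bravais hosts (hcp, stackings, twins near the composition plane) are NOT mirror-closed at general sites: use the point-group form
`…CertFloorTailsHostGroup` or the exact short rest `…CertFloorTailsHost.hostForce_eq_sum_unmirrored` (Tier N).
One computable def (`mirrorNbh`, + `mirT`); imports TREE `…CellArithNash` (p859767) and `…CellTriples` (p859824); 0 sorry.  All `[folklore]`.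
-/

noncomputable section

namespace Summit.AtomisticToContinuum.Crystallization.Theorems.FrustratedLawDichotomyCellHostMirror

open Metric Set RealInnerProductSpace
open scoped BigOperators
open Summit.AtomisticToContinuum.Crystallization.Theorems.ChargedEnergyGapNegative (E3)
open Summit.AtomisticToContinuum.Crystallization.Theorems.FrustratedLawDichotomyCoherentFloorAlgebra (psiT ljBondForce)
open Summit.AtomisticToContinuum.Crystallization.Theorems.FrustratedLawDichotomyCellFrame (injOn_of_sep)
open Summit.AtomisticToContinuum.Crystallization.Theorems.FrustratedLawDichotomyCellTails
  (psiTail sum_ljBondForce_eq_zero_of_mirror hostForceL_le_near_add_tail)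
open Summit.AtomisticToContinuum.Crystallization.Theorems.FrustratedLawDichotomyCellMetric (posL posL_mirror posL_sub posL_smul)
open Summit.AtomisticToContinuum.Crystallization.Theorems.FrustratedLawDichotomyCellData (le_norm_of_nearId)
open Summit.AtomisticToContinuum.Crystallization.Theorems.FrustratedLawDichotomyCellTriples (zT sumT)
open Summit.AtomisticToContinuum.Crystallization.Theorems.FrustratedLawDichotomyCellArith
open Summit.AtomisticToContinuum.Crystallization.Theorems.FrustratedLawDichotomyCellArithTails (psiTailQ le_psiTailHiZ)

variable {ι : Type*} [DecidableEq ι]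

/-! ## §1. The mirror core as the near list: its bonds carry no net force -/

/-- The MIRROR CORE of an interior label `m`: the template labels `m' ∈ M` whose label mirror `mir m m'` (`= 2m − m'` for an additive label
group) is again a template label.  This is the `nbh` argument of (251) `lb_le_certFloorL_trunc` for Bravais templates. -/
def mirrorNbh (M : Finset ι) (mir : ι → ι → ι) (m : ι) : Finset ι := M.filter fun m' => mir m m' ∈ M

/-- membership in the mirror core. [folklore] -/
theorem mem_mirrorNbh {M : Finset ι} {mir : ι → ι → ι} {m m' : ι} : m' ∈ mirrorNbh M mir m ↔ m' ∈ M ∧ mir m m' ∈ M := by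
  classical
  simp [mirrorNbh]

section LabelFrame

variable {M MI : Finset ι} {pos Y : ι → E3} {mir : ι → ι → ι}

/-- ★ THE NEAR PART VANISHES: for a placement `pos` injective on `M` whose label mirror REVERSES BONDS at `m`
(`pos m − pos (mir m m') = −(pos m − pos m')`, e.g. (252) `posL_mirror` for affine templates) and is an involution on `M`,
the bonds from `m` to its mirror core sum to zero ((250) `sum_ljBondForce_eq_zero_of_mirror`, odd pairing). [folklore] -/
theorem sum_ljBondForce_mirrorNbh_eq_zero (hinj : Set.InjOn pos ↑M) {m : ι} (hm : m ∈ M)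
    (hrev : ∀ m' ∈ M, pos m - pos (mir m m') = -(pos m - pos m')) (hinv : ∀ m' ∈ M, mir m (mir m m') = m') :
    ∑ m' ∈ (M.erase m).filter (fun m' => m' ∈ mirrorNbh M mir m), ljBondForce (pos m - pos m') = 0 := by
  classical
  set NB := (M.erase m).filter (fun m' => m' ∈ mirrorNbh M mir m) with hNB
  have hNBM : NB ⊆ M := (Finset.filter_subset _ _).trans (Finset.erase_subset m M)
  -- membership in NB unpacked
  have memNB : ∀ {x}, x ∈ NB ↔ x ∈ M ∧ x ≠ m ∧ mir m x ∈ M := by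
    intro x
    rw [hNB, Finset.mem_filter, Finset.mem_erase, mem_mirrorNbh]
    tauto
  refine sum_ljBondForce_eq_zero_of_mirror NB m (mir m) (fun m' hm' => ?_) (fun m' hm' => hrev m' (hNBM hm')) (hinj.mono hNBM)
  obtain ⟨hm'M, hm'ne, hmirM⟩ := memNB.mp hm'
  refine memNB.mpr ⟨hmirM, ?_, by rw [hinv m' hm'M]; exact hm'M⟩
  -- `mir m m' ≠ m`: otherwise the reversed bond forces `pos m' = pos m`
  intro heq
  have h := hrev m' hm'M
  rw [heq, sub_self, eq_comm, neg_eq_zero, sub_eq_zero] at h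
  exact hm'ne (hinj hm'M hm h.symm)

/-- ★ THE (251) `hhf` ENTRY for the mirror near list: the pairing reduces to the tail, `‖Y m‖·T0_δ(Lh m) ≤ hf m` suffices. [folklore] -/
theorem hhf_of_mirror (hinj : Set.InjOn pos ↑M) (hMI : MI ⊆ M)
    (hrev : ∀ m ∈ MI, ∀ m' ∈ M, pos m - pos (mir m m') = -(pos m - pos m')) (hinv : ∀ m ∈ MI, ∀ m' ∈ M, mir m (mir m m') = m')
    {δ : ℝ} {Lh hf : ι → ℝ} (hhf : ∀ m ∈ MI, ‖Y m‖ * psiTail δ (Lh m) ≤ hf m) :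
    ∀ m ∈ MI, ⟪Y m, ∑ m' ∈ (M.erase m).filter (fun m' => m' ∈ mirrorNbh M mir m), ljBondForce (pos m - pos m')⟫
      + ‖Y m‖ * psiTail δ (Lh m) ≤ hf m := by
  intro m hm
  rw [sum_ljBondForce_mirrorNbh_eq_zero hinj (hMI hm) (hrev m hm) (hinv m hm), inner_zero_right, zero_add]
  exact hhf m hm

/-! ## §2. Window completeness ⇒ the side condition `hnbh`; the column form -/

/-- ★ THE (251) `hnbh` SIDE CONDITION from WINDOW COMPLETENESS: if every admissible label placed strictly inside radius `R_w` belongs to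
`M` (`hout`, contrapositive form), admissibility is closed under the mirror at `m`, the mirror reverses bonds at `m`, and
`Lh m + ‖pos m‖ ≤ R_w`, then every template label OFF the mirror core of `m` is at distance `≥ Lh m` from `pos m`. [folklore] -/
theorem lh_le_dist_of_window {adm : ι → Prop} {R_w : ℝ} (hout : ∀ x, adm x → x ∉ M → R_w ≤ ‖pos x‖) {m : ι}
    (hadm : ∀ m' ∈ M, adm (mir m m')) (hrev : ∀ m' ∈ M, pos m - pos (mir m m') = -(pos m - pos m'))
    {Lm : ℝ} (hLm : Lm + ‖pos m‖ ≤ R_w) :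
    ∀ m' ∈ M, m' ≠ m → m' ∉ mirrorNbh M mir m → Lm ≤ dist (pos m') (pos m) := by
  intro m' hm'M _ hnot
  have hmir : mir m m' ∉ M := fun h => hnot (mem_mirrorNbh.mpr ⟨hm'M, h⟩)
  have hR := hout _ (hadm m' hm'M) hmir
  -- `pos (mir m m') = pos m + (pos m − pos m')`
  have e : pos (mir m m') = pos m + (pos m - pos m') := by
    have h := hrev m' hm'M
    have : pos (mir m m') = pos m - -(pos m - pos m') := by rw [← h]; abel
    rw [this]; abel
  have htri : ‖pos (mir m m')‖ ≤ ‖pos m‖ + dist (pos m') (pos m) := by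
    rw [e, dist_comm, dist_eq_norm]
    exact norm_add_le _ _
  linarith

/-- ★ `hnbh` of (251) `lb_le_certFloorL_trunc` VERBATIM for `nbh := mirrorNbh M mir`, over the interior set `MI`: window completeness,
admissibility closure, bond reversal and `Lh m + ‖pos m‖ ≤ R_w` per interior label (the last from (260) `norm_add_le_of_nearId` with
`τ := Lh m` on a near-identity cell). [folklore] -/
theorem hnbh_of_window {adm : ι → Prop} {R_w : ℝ} (hout : ∀ x, adm x → x ∉ M → R_w ≤ ‖pos x‖)
    (hadm : ∀ m ∈ MI, ∀ m' ∈ M, adm (mir m m')) (hrev : ∀ m ∈ MI, ∀ m' ∈ M, pos m - pos (mir m m') = -(pos m - pos m'))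
    {Lh : ι → ℝ} (hLw : ∀ m ∈ MI, Lh m + ‖pos m‖ ≤ R_w) :
    ∀ m ∈ MI, ∀ m' ∈ M, m' ≠ m → m' ∉ mirrorNbh M mir m → Lh m ≤ dist (pos m') (pos m) :=
  fun m hm => lh_le_dist_of_window hout (hadm m hm) (hrev m hm) (hLw m hm)

/-- ★★ THE HOST COLUMN IN THE LABEL FRAME WITHOUT FORCE EVALUATIONS (label twin of `…CertFloorTailsHost.hostColumn_abs_le_of_window`):
`δ`-separated placement, interior `MI ⊆ M`, bond-reversing involutive mirror at every interior label, window completeness at radius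
`R_w`, radii `δ/2 ≤ Lh m ≤ R_w − ‖pos m‖` ⇒
`Σ_{m∈MI} ⟪Y m, Σ_{m'∈M∖m} ljBondForce (pos m − pos m')⟫ ≤ Σ_{m∈MI} ‖Y m‖·T0_δ(Lh m)`. [folklore] -/
theorem hostColumnL_le_of_mirror {δ : ℝ} (hδ : 0 < δ) (hsep : ∀ z ∈ M, ∀ z' ∈ M, z ≠ z' → δ ≤ dist (pos z) (pos z'))
    (hMI : MI ⊆ M) {adm : ι → Prop} {R_w : ℝ} (hout : ∀ x, adm x → x ∉ M → R_w ≤ ‖pos x‖)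
    (hadm : ∀ m ∈ MI, ∀ m' ∈ M, adm (mir m m')) (hrev : ∀ m ∈ MI, ∀ m' ∈ M, pos m - pos (mir m m') = -(pos m - pos m'))
    (hinv : ∀ m ∈ MI, ∀ m' ∈ M, mir m (mir m m') = m') {Lh : ι → ℝ} (hLh : ∀ m ∈ MI, δ / 2 ≤ Lh m)
    (hLw : ∀ m ∈ MI, Lh m + ‖pos m‖ ≤ R_w) :
    ∑ m ∈ MI, ⟪Y m, ∑ m' ∈ M.erase m, ljBondForce (pos m - pos m')⟫ ≤ ∑ m ∈ MI, ‖Y m‖ * psiTail δ (Lh m) := by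
  have hinj : Set.InjOn pos ↑M := injOn_of_sep hδ hsep
  refine Finset.sum_le_sum fun m hm => ?_
  have h := hostForceL_le_near_add_tail (Y := Y) (mirrorNbh M mir) hδ hsep (hMI hm) (hLh m hm)
    (lh_le_dist_of_window hout (hadm m hm) (hrev m hm) (hLw m hm))
  rw [sum_ljBondForce_mirrorNbh_eq_zero hinj (hMI hm) (hrev m hm) (hinv m hm), inner_zero_right, zero_add] at h
  exact h

end LabelFrame

/-! ## §3. The number: `hf m := scHi yb (rdHi S (psiTailQ δ Lh))/S` (Gram frame, ℤ readings at scale `S`) -/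

section Reading

variable {S : ℤ}

/-- `0 ≤ T0_δ(L)` for `0 < δ`, `0 < L`. [folklore] -/
theorem psiTail_nonneg {δ L : ℝ} (hδ : 0 < δ) (hL : 0 < L) : 0 ≤ psiTail δ L := by
  unfold psiTail Summit.AtomisticToContinuum.Crystallization.Theorems.FrustratedLawDichotomyCellTails.S4
    Summit.AtomisticToContinuum.Crystallization.Theorems.FrustratedLawDichotomyCellTails.S10
  positivity

/-- ★ THE MIRROR HOST ENTRY READ IN `ℤ`: a norm witness `a ≤ yb` (`a = ‖Y m‖`, e.g. by (260) `norm_le_of_nearId` / (hand-1)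
`norm_posL_le_ratWitness`) and rational dials `0 < δ`, `0 < Lh` give `a·T0_δ(Lh) ≤ scHi yb (rdHi S (psiTailQ δ Lh))/S`. [folklore] -/
theorem norm_mul_psiTail_le_reading {a : ℝ} {yb δ Lh : ℚ} (hS : 0 < S) (ha0 : 0 ≤ a) (ha : a ≤ (yb : ℝ)) (hδ : 0 < δ) (hLh : 0 < Lh) :
    a * psiTail (δ : ℝ) (Lh : ℝ) ≤ ((scHi yb (rdHi S (psiTailQ δ Lh)) : ℤ) : ℝ) / S := by
  refine le_div_of_reading hS ?_
  have hpt := le_psiTailHiZ (S := S) δ Lh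
  have hpt0 : 0 ≤ psiTail (δ : ℝ) (Lh : ℝ) := psiTail_nonneg (by exact_mod_cast hδ) (by exact_mod_cast hLh)
  have hy : (S : ℝ) * (a * psiTail (δ : ℝ) (Lh : ℝ)) ≤ S * ((yb : ℝ) * psiTail (δ : ℝ) (Lh : ℝ)) :=
    mul_le_mul_of_nonneg_left (mul_le_mul_of_nonneg_right ha hpt0) (by exact_mod_cast hS.le)
  have hyb0 : 0 ≤ yb := by
    have : (0 : ℝ) ≤ yb := ha0.trans ha
    exact_mod_cast this
  exact hy.trans (le_scHi (c := yb) hyb0 hpt)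

/-- ★ THE (251) `hhf` COLUMN DISCHARGED, Gram frame: placements `pos m = posL F (a m)`, multipliers `Y m = posL F (ω m)`, the mirror
near list, per-label norm witnesses `‖posL F (ω m)‖ ≤ yb m` and rational radii `Lh m > 0` ⇒ the entry with
`hf m := scHi (yb m) (rdHi S (psiTailQ δ (Lh m)))/S`.  (With `yb`, `Lh` tables composed with an orbit map `rep` the number is per
representative.) [folklore] -/
theorem hhf_of_mirror_reading (F : Matrix (Fin 3) (Fin 3) ℝ) {M MI : Finset ι} {a ω : ι → Fin 3 → ℝ} {mir : ι → ι → ι}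
    (hinj : Set.InjOn (fun m => posL F (a m)) ↑M) (hMI : MI ⊆ M)
    (hrev : ∀ m ∈ MI, ∀ m' ∈ M, posL F (a m) - posL F (a (mir m m')) = -(posL F (a m) - posL F (a m')))
    (hinv : ∀ m ∈ MI, ∀ m' ∈ M, mir m (mir m m') = m') (hS : 0 < S) {δ : ℚ} (hδ : 0 < δ) {yb Lh : ι → ℚ}
    (hyb : ∀ m ∈ MI, ‖posL F (ω m)‖ ≤ (yb m : ℝ)) (hLh : ∀ m ∈ MI, 0 < Lh m) :
    ∀ m ∈ MI, ⟪posL F (ω m), ∑ m' ∈ (M.erase m).filter (fun m' => m' ∈ mirrorNbh M mir m),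
        ljBondForce (posL F (a m) - posL F (a m'))⟫ + ‖posL F (ω m)‖ * psiTail (δ : ℝ) ((Lh m : ℚ) : ℝ)
      ≤ ((scHi (yb m) (rdHi S (psiTailQ δ (Lh m))) : ℤ) : ℝ) / S :=
  hhf_of_mirror (pos := fun m => posL F (a m)) (Y := fun m => posL F (ω m)) hinj hMI hrev hinv
    (Lh := fun m => ((Lh m : ℚ) : ℝ)) (hf := fun m => ((scHi (yb m) (rdHi S (psiTailQ δ (Lh m))) : ℤ) : ℝ) / S)
    fun m hm => norm_mul_psiTail_le_reading hS (norm_nonneg _) (hyb m hm) hδ (hLh m hm)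

end Reading

/-! ## §4. The integer-triple instance: `mirT m m' = 2m − m'`, template linearity, parity, near-identity window completeness -/

section Triples

/-- The label mirror of integer triples: `mirT m m' := 2m − m'`. -/
def mirT (m m' : ℤ × ℤ × ℤ) : ℤ × ℤ × ℤ := (2 * m.1 - m'.1, 2 * m.2.1 - m'.2.1, 2 * m.2.2 - m'.2.2)

/-- coordinates of the mirror. [folklore] -/
theorem zT_mirT (m m' : ℤ × ℤ × ℤ) (i : Fin 3) : zT (mirT m m') i = 2 * zT m i - zT m' i := by
  fin_cases i <;> rfl

/-- `mirT m` is an involution. [folklore] -/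
theorem mirT_mirT (m m' : ℤ × ℤ × ℤ) : mirT m (mirT m m') = m' := by
  obtain ⟨a, b, c⟩ := m
  obtain ⟨a', b', c'⟩ := m'
  simp only [mirT, Prod.mk.injEq]
  refine ⟨by ring, by ring, by ring⟩

/-- `mirT m m = m`. [folklore] -/
theorem mirT_self (m : ℤ × ℤ × ℤ) : mirT m m = m := by
  obtain ⟨a, b, c⟩ := m
  simp only [mirT, Prod.mk.injEq]
  refine ⟨by ring, by ring, by ring⟩

/-- the coordinate sum of the mirror: `sumT (mirT m m') = 2·sumT m − sumT m'`. [folklore] -/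
theorem sumT_mirT (m m' : ℤ × ℤ × ℤ) : sumT (mirT m m') = 2 * sumT m - sumT m' := by
  simp only [sumT, mirT]; ring

/-- ★ PARITY CLOSURE: the parity lattice `{Σ even}` (fcc labels and every affine strain of it) is closed under every label mirror. [folklore] -/
theorem even_sumT_mirT (m : ℤ × ℤ × ℤ) {m' : ℤ × ℤ × ℤ} (h : Even (sumT m')) : Even (sumT (mirT m m')) := by
  rw [sumT_mirT]
  exact (even_two_mul _).sub h

/-- the real label vector of the mirror: `cast ∘ zT (mirT m m') = 2•(cast ∘ zT m) − cast ∘ zT m'`. [folklore] -/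
theorem cast_zT_mirT (m m' : ℤ × ℤ × ℤ) :
    (fun i => (zT (mirT m m') i : ℝ)) = (2 : ℝ) • (fun i => (zT m i : ℝ)) - fun i => (zT m' i : ℝ) := by
  funext i
  simp only [zT_mirT, Pi.sub_apply, Pi.smul_apply, smul_eq_mul]
  push_cast
  ring

/-- ★ BOND REVERSAL for the ISOTROPIC integer template `a m = h • zT m`: the hypothesis `hrev` of §1–§3. [folklore] -/
theorem posL_intTemplate_mirT (F : Matrix (Fin 3) (Fin 3) ℝ) (h : ℝ) (m m' : ℤ × ℤ × ℤ) :
    posL F (fun i => h * (zT m i : ℝ)) - posL F (fun i => h * (zT (mirT m m') i : ℝ))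
      = -(posL F (fun i => h * (zT m i : ℝ)) - posL F (fun i => h * (zT m' i : ℝ))) := by
  have e : (fun i => h * (zT (mirT m m') i : ℝ))
      = (2 : ℝ) • (fun i => h * (zT m i : ℝ)) - fun i => h * (zT m' i : ℝ) := by
    funext i
    simp only [zT_mirT, Pi.sub_apply, Pi.smul_apply, smul_eq_mul]
    push_cast
    ring
  rw [e]
  exact posL_mirror F _ _

/-- ★ BOND REVERSAL for a LINEAR template `a m = T *ᵥ zT m` (F1 and every T-cell): the hypothesis `hrev` of §1–§3. [folklore] -/
theorem posL_linTemplate_mirT (F T : Matrix (Fin 3) (Fin 3) ℝ) (m m' : ℤ × ℤ × ℤ) :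
    posL F (T.mulVec fun i => (zT m i : ℝ)) - posL F (T.mulVec fun i => (zT (mirT m m') i : ℝ))
      = -(posL F (T.mulVec fun i => (zT m i : ℝ)) - posL F (T.mulVec fun i => (zT m' i : ℝ))) := by
  rw [cast_zT_mirT, Matrix.mulVec_sub, Matrix.mulVec_smul]
  exact posL_mirror F _ _

/-- ★ WINDOW COMPLETENESS on a near-identity cell, the `hout` hypothesis of §2: if every admissible label NOT in `M` has template norm
`R_w² ≤ (1 − 3ε)·|a x|²` (an integer/rational fact of the label predicate: `q x ≥ Z_c + 1` off `M`), then it is placed at distance `≥ R_w`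
from the root for every `F` of the box ((260) `le_norm_of_nearId`). [folklore] -/
theorem hout_of_nearId {κ : Type*} {F : Matrix (Fin 3) (Fin 3) ℝ} {ε : ℝ}
    (hG : ∀ i j, |(F.transpose * F) i j - (if i = j then 1 else 0)| ≤ ε) {M : Finset κ} {adm : κ → Prop} {a : κ → Fin 3 → ℝ}
    {R_w : ℝ} (hfar : ∀ x, adm x → x ∉ M → R_w ^ 2 ≤ (1 - 3 * ε) * ∑ i, a x i ^ 2) :
    ∀ x, adm x → x ∉ M → R_w ≤ ‖posL F (a x)‖ :=
  fun x hx hxM => le_norm_of_nearId hG (hfar x hx hxM)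

end Triples

/-! ## §5. Window completeness in template terms (the `hfar` of `hout_of_nearId`); integer equivariance of multiplier tables
(appended, hand-1 g54: the ONE Labels-file fact of the mirror host column reduced to an integer threshold + one rational check) -/

section Window

variable {κ : Type*} {M : Finset κ} {adm : κ → Prop}

/-- predicate logic of a window list: if `M` contains every admissible label of the enumeration box with `q ≤ Z_c`, and `q ≤ Z_c` forces
the box, then every admissible label OFF `M` has `Z_c + 1 ≤ q`. [folklore] -/
theorem offWindow_of_predicate {inBox : κ → Prop} {q : κ → ℤ} {Zc : ℤ}
    (hM : ∀ x, adm x → inBox x → q x ≤ Zc → x ∈ M) (hbox : ∀ x, q x ≤ Zc → inBox x) :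
    ∀ x, adm x → x ∉ M → Zc + 1 ≤ q x := by
  intro x hx hxM
  by_contra hlt
  have hq : q x ≤ Zc := by omega
  exact hxM (hM x hx (hbox x hq) hq)

/-- ★ `hfar` OF `hout_of_nearId` FROM THE INTEGER WINDOW: a template whose squared label norm is `q x / D²` (dyadic linear templates:
(285) `sumSq_linTemplate_eq_qZ_div`; isotropic `h•z`: `q = |z|²`, `D = h⁻¹`), the integer threshold `Z_c + 1 ≤ q x` off `M`
(`offWindow_of_predicate`) and ONE rational check `R_w²·D² ≤ (1 − 3ε)(Z_c + 1)` give `R_w² ≤ (1 − 3ε)·Σ (a x i)²` off `M`. [folklore] -/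
theorem hfar_of_intWindow {a : κ → Fin 3 → ℝ} {q : κ → ℤ} {D ε R_w : ℝ} {Zc : ℤ} (hD : 0 < D)
    (hq : ∀ x, ∑ i, a x i ^ 2 = (q x : ℝ) / D ^ 2) (hε : 0 ≤ 1 - 3 * ε) (hR : R_w ^ 2 * D ^ 2 ≤ (1 - 3 * ε) * ((Zc : ℝ) + 1))
    (hoff : ∀ x, adm x → x ∉ M → Zc + 1 ≤ q x) :
    ∀ x, adm x → x ∉ M → R_w ^ 2 ≤ (1 - 3 * ε) * ∑ i, a x i ^ 2 := by
  intro x hx hxM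
  have h1 : (Zc : ℝ) + 1 ≤ (q x : ℝ) := by exact_mod_cast hoff x hx hxM
  have h2 : R_w ^ 2 * D ^ 2 ≤ (1 - 3 * ε) * (q x : ℝ) := hR.trans (mul_le_mul_of_nonneg_left h1 hε)
  have hD2 : 0 < D ^ 2 := by positivity
  rw [hq x, show (1 - 3 * ε) * ((q x : ℝ) / D ^ 2) = (1 - 3 * ε) * (q x : ℝ) / D ^ 2 by ring, le_div_iff₀ hD2]
  exact h2

end Window

/-- ★ integer variant of (285) `castVec_equivar` for multiplier NUMERATORS `ω = w/D` (KFILE-FORMAT ed2b §7′): a vector table decided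
equivariant in `ℤ` (`v = R·u`) is equivariant in `ℝ` after division by the common denominator `D`. [folklore] -/
theorem castVecZ_div_equivar (RZ : Matrix (Fin 3) (Fin 3) ℤ) {u v : Fin 3 → ℤ} (h : v = RZ.mulVec u) (D : ℝ) :
    (fun i => (v i : ℝ) / D) = (RZ.map fun t : ℤ => (t : ℝ)).mulVec fun i => (u i : ℝ) / D := by
  funext i
  rw [h]
  simp only [Matrix.mulVec, dotProduct, Matrix.map_apply]
  push_cast
  rw [Finset.sum_div]
  exact Finset.sum_congr rfl fun j _ => by ring

/-! ## §6. Local window completeness (appended, hand-1 g54): the `hnbh` side condition per interior label — for cells whose label set is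
NOT a root-centred ball (class-H half-space windows (253), cut cells): the mirror of an off-core partner is an admissible label outside `M`,
and BY REFLECTION it is exactly as far from `m` as the partner itself, so a LOCAL completeness radius `Lh m` around each interior label
(«every admissible label within `Lh m` of `pos m` is in `M`», e.g. depth below the cut plane) gives `hnbh` with no reference to the root. -/

section LocalWindow

variable {M MI : Finset ι} {pos : ι → E3} {mir : ι → ι → ι}

omit [DecidableEq ι] in
/-- reflection preserves the distance to the centre: `dist (pos (mir m m')) (pos m) = dist (pos m') (pos m)`. [folklore] -/
theorem dist_mirror_eq {m m' : ι} (hrev : pos m - pos (mir m m') = -(pos m - pos m')) :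
    dist (pos (mir m m')) (pos m) = dist (pos m') (pos m) := by
  rw [dist_eq_norm, dist_eq_norm, ← neg_sub (pos m) (pos (mir m m')), norm_neg, hrev, norm_neg, ← neg_sub (pos m') (pos m), norm_neg]

/-- ★ `hnbh` at ONE interior label from LOCAL completeness: every admissible label within `Lm` of `pos m` lies in `M` (contrapositive
form `houtL`), admissibility closed under the mirror at `m`, bond reversal at `m`. [folklore] -/
theorem lh_le_dist_of_local {adm : ι → Prop} {m : ι} {Lm : ℝ} (houtL : ∀ x, adm x → x ∉ M → Lm ≤ dist (pos x) (pos m))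
    (hadm : ∀ m' ∈ M, adm (mir m m')) (hrev : ∀ m' ∈ M, pos m - pos (mir m m') = -(pos m - pos m')) :
    ∀ m' ∈ M, m' ≠ m → m' ∉ mirrorNbh M mir m → Lm ≤ dist (pos m') (pos m) := by
  intro m' hm'M _ hnot
  have hmir : mir m m' ∉ M := fun h => hnot (mem_mirrorNbh.mpr ⟨hm'M, h⟩)
  rw [← dist_mirror_eq (hrev m' hm'M)]
  exact houtL _ (hadm m' hm'M) hmir

/-- ★ `hnbh` of (251) VERBATIM for `nbh := mirrorNbh M mir` from LOCAL completeness radii `Lh m` (class-H / cut cells; for root-centred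
balls use `hnbh_of_window`). [folklore] -/
theorem hnbh_of_local {adm : ι → Prop} {Lh : ι → ℝ} (houtL : ∀ m ∈ MI, ∀ x, adm x → x ∉ M → Lh m ≤ dist (pos x) (pos m))
    (hadm : ∀ m ∈ MI, ∀ m' ∈ M, adm (mir m m')) (hrev : ∀ m ∈ MI, ∀ m' ∈ M, pos m - pos (mir m m') = -(pos m - pos m')) :
    ∀ m ∈ MI, ∀ m' ∈ M, m' ≠ m → m' ∉ mirrorNbh M mir m → Lh m ≤ dist (pos m') (pos m) :=
  fun m hm => lh_le_dist_of_local (houtL m hm) (hadm m hm) (hrev m hm)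

omit [DecidableEq ι] in
/-- the root-centred completeness is a special case: `hout` at radius `R_w` and `Lh m + ‖pos m‖ ≤ R_w` give the local form. [folklore] -/
theorem houtL_of_window {adm : ι → Prop} {R_w : ℝ} (hout : ∀ x, adm x → x ∉ M → R_w ≤ ‖pos x‖) {m : ι} {Lm : ℝ}
    (hLm : Lm + ‖pos m‖ ≤ R_w) : ∀ x, adm x → x ∉ M → Lm ≤ dist (pos x) (pos m) := by
  intro x hx hxM
  have h := hout x hx hxM
  have htri : ‖pos x‖ ≤ dist (pos x) (pos m) + ‖pos m‖ := by
    have := norm_le_norm_add_norm_sub' (pos x) (pos m)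
    rw [dist_eq_norm]; linarith [norm_sub_rev (pos x) (pos m), this]
  linarith

end LocalWindow

end Summit.AtomisticToContinuum.Crystallization.Theorems.FrustratedLawDichotomyCellHostMirror

end
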